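import Mathlib
import Summits.KontsevichZagierPeriods.KontsevichZagierPeriods.Theorems.InverseLandauTateFamilyKernelStubGpDivision
import Summits.KontsevichZagierPeriods.KontsevichZagierPeriods.Theorems.InverseLandauTateFamilyKernelStubLinResidues

/-!
# Crux `TateFamilyKernel` (stmt-KontsevichZagierPeriods-9130), line `Sketch`: stub `stub_gvDivision`

Step GV3b (LOG-ELIMINATION + EUCLIDEAN DIVISION) of the linear-slope graph-pencil class
`Q = 1 − ϖ·(u(z₂) + (γ + δz₂)z₁)` (`u ∈ ℚ[s]`, slope `v = γ + δs`, `δ ≠ 0`) of the lead's skeleton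
of `Summit.KontsevichZagierPeriods.KontsevichZagierPeriods.Theses.InverseLandau.TateFamilyKernel`
(variables `X 0 = y` resp. `z₁`, `X 1 = s = z₂`). Input: the single-branch primitive of GV3a,
`∫_s^1 P((y−u(σ))/v(σ), σ)/v(σ) dσ = F(y,1) − F(y,s)` with `F = Rn/v^k + a(y)·log|v|`, and the
vanishing of this integral along the graph `y_s = u(s) + v(s)`, `s ∈ (s₁,1)` (GV2). Output: the
TWISTED IDENTITY `v^m·P = (u' + δz₁)·∂₀Nt − v·∂₁Nt + mδ·Nt` consumed by GV4.

1. *The `log`-coefficient vanishes* (`GvDivision.log_coeff_eq_zero`): along the graph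
   `a(y_s)·v(s)^k·log|v(s)|` is a real polynomial in `s`; the affine substitution `s = −γ/δ ± t`
   (`t > 0`) turns this into `g(t)·log t = f(t)`, so `g = 0` (`LinResidues.eq_zero_of_mul_log_eq`);
   hence `a ∘ (u+v) = 0` on `(s₁,1)` and `a = 0` (`u + v` is injective there).
2. *Exponent `k + 1`*: replacing `Rn` by `Rn·v` the exponent becomes `k + 1 ≥ 1` (`m = k`).
3. *Infinitely many zeros + factor theorem* (`GvDivision.twisted`): `c·Rn − Rn(y,1)·v^{k+1}`
   (`c = (γ+δ)^{k+1} ≠ 0`) vanishes at `y = y_s`, `s ∈ (s₁,1)`, hence equals `(y − u − v)·G`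
   (`GpDivision.eq_zero_of_aeval_eq_zero`, `GpDivision.X_sub_dvd`).
4. *FTC* (`GvDivision.hasDerivAt_of_integral_eq`, `GvDivision.key_identity`) read at the points
   `y = u(s) + v(s)z₁`: `P·v^{k+1} = θ(∂₁Rn)·v − (k+1)δ·θ(Rn)` in `ℚ[z₁, s]`, `θ : y ↦ u + v·z₁`
   (`θ` inverts `P ↦ P((y−u)/v, s)`, so no denominators have to be cleared).
5. *Differentiate (3) in `s`, apply `θ`, cancel one factor `v`, chain rule*
   (`LinExact.pderiv_bind₁`): `Nt = (1 − z₁)·θ(G)/c`.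

References: Kontsevich–Zagier 2001, §1.2. Mathlib and the landed files `…StubGpDivision`,
`…StubLinExact`, `…StubLinResidues` only; no named fact, no new definition.
-/

noncomputable section

open MeasureTheory Set MvPolynomial
open Literature.NumberTheory.Transcendental

namespace Summit.KontsevichZagierPeriods.InverseLandau.TateFamilyKernel.Descent

namespace GvDivision

/-- Substituting real polynomials of `σ` into `R ∈ ℚ[y, s]` gives a real polynomial of `σ`.
[folklore] -/
theorem exists_poly (p₀ p₁ : Polynomial ℝ) (R : MvPolynomial (Fin 2) ℚ) :
    ∃ p : Polynomial ℝ, ∀ σ : ℝ, aeval ![p₀.eval σ, p₁.eval σ] R = p.eval σ := by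
  induction R using MvPolynomial.induction_on with
  | C c => exact ⟨Polynomial.C (c : ℝ), fun σ => by simp⟩
  | add p q hp hq =>
    obtain ⟨f, hf⟩ := hp
    obtain ⟨g, hg⟩ := hq
    exact ⟨f + g, fun σ => by simp only [map_add, hf, hg, Polynomial.eval_add]⟩
  | mul_X p i hp =>
    obtain ⟨f, hf⟩ := hp
    fin_cases i
    · exact ⟨f * p₀, fun σ => by simp [hf]⟩
    · exact ⟨f * p₁, fun σ => by simp [hf]⟩

/-- **`log |γ + δs|` is not rational on an interval.** If `g(s)·log|γ + δs| = f(s)` on `(s₁, 1)`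
for real polynomials `f, g`, where `δ ≠ 0` and `γ + δs ≠ 0` on `[s₁, 1]`, then `g = 0`: the affine
substitution `s = −γ/δ + εt` (`ε = ±1`, `t > 0`) reduces to `LinResidues.eq_zero_of_mul_log_eq`.
[folklore] -/
theorem eq_zero_of_mul_log_affine (γ δ s₁ : ℝ) (hδ : δ ≠ 0) (hs₁ : s₁ < 1)
    (hv : ∀ σ ∈ Icc s₁ 1, γ + δ * σ ≠ 0) (f g : Polynomial ℝ)
    (h : ∀ s ∈ Ioo s₁ 1, g.eval s * Real.log |γ + δ * s| = f.eval s) : g = 0 := by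
  obtain ⟨r, hr⟩ : ∃ r : ℝ, r = -γ / δ := ⟨_, rfl⟩
  have hγ : γ = -(δ * r) := by rw [hr]; field_simp
  have hr' : r < s₁ ∨ 1 < r := by
    by_contra hc
    exact hv r ⟨not_lt.1 fun h => hc (Or.inl h), not_lt.1 fun h => hc (Or.inr h)⟩ (by rw [hγ]; ring)
  obtain ⟨ε, a, b, hε, ha, hab, hmem⟩ : ∃ ε a b : ℝ, |ε| = 1 ∧ 0 < a ∧ a < b ∧
      ∀ t ∈ Ioo a b, r + ε * t ∈ Ioo s₁ 1 := by
    rcases hr' with hr' | hr'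
    · exact ⟨1, s₁ - r, 1 - r, abs_one, by linarith, by linarith,
        fun t ht => ⟨by linarith [ht.1], by linarith [ht.2]⟩⟩
    · exact ⟨-1, r - 1, r - s₁, by simp, by linarith, by linarith,
        fun t ht => ⟨by linarith [ht.2], by linarith [ht.1]⟩⟩
  have hε2 : ε * ε = 1 := by rw [← abs_mul_abs_self, hε, one_mul]
  obtain ⟨q, hq⟩ : ∃ q : Polynomial ℝ, q = Polynomial.C r + Polynomial.C ε * Polynomial.X :=
    ⟨_, rfl⟩
  have hqe : ∀ t, q.eval t = r + ε * t := fun t => by simp [hq]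
  have hfg : ∀ t ∈ Ioo a b, (g.comp q).eval t * Real.log t =
      (f.comp q - Polynomial.C (Real.log |δ|) * g.comp q).eval t := by
    intro t ht
    have ht0 : 0 < t := ha.trans ht.1
    have h1 := h (r + ε * t) (hmem t ht)
    rw [hγ, show -(δ * r) + δ * (r + ε * t) = δ * (ε * t) by ring, abs_mul, abs_mul, hε, one_mul,
      abs_of_pos ht0, Real.log_mul (abs_ne_zero.2 hδ) ht0.ne'] at h1
    simp only [Polynomial.eval_comp, Polynomial.eval_sub, Polynomial.eval_mul, Polynomial.eval_C,
      hqe]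
    linear_combination h1
  have h0 := LinResidues.eq_zero_of_mul_log_eq ha hab _ _ _ le_rfl hfg
  refine Polynomial.eq_zero_of_infinite_isRoot _ ((Ioo_infinite hs₁).mono fun s _ => ?_)
  have h3 : (g.comp q).eval (ε * (s - r)) = 0 := by rw [h0, Polynomial.eval_zero]
  rwa [Polynomial.eval_comp, hqe, show r + ε * (ε * (s - r)) = s by
    linear_combination (s - r) * hε2] at h3

/-- **Step 1 of `stub_gvDivision`: the `log`-coefficient vanishes.** If along the graph
`y_s = u(s) + γ + δs` (`s ∈ (s₁, 1)`, where `u + v` is injective) the primitive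
`Rn(y,σ)/(γ+δσ)^k + a(y)·log|γ+δσ|` takes the same value at `σ = s` and at `σ = 1`, then `a = 0`:
`a(y_s)(γ+δs)^k · log|γ+δs|` is a real polynomial in `s` (`exists_poly`), so `a(y_s) = 0`
(`eq_zero_of_mul_log_affine`) for the infinitely many values `y_s`. [folklore] -/
theorem log_coeff_eq_zero (u : Polynomial ℚ) (γ δ : ℚ) (hδ : δ ≠ 0) (Rn : MvPolynomial (Fin 2) ℚ)
    (k : ℕ) (a : Polynomial ℚ) (s₁ : ℝ) (hs₁ : s₁ < 1)
    (hvs : ∀ σ ∈ Icc s₁ 1, (γ : ℝ) + δ * σ ≠ 0)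
    (hinj : InjOn (fun s : ℝ => Polynomial.aeval s u + (γ + δ * s)) (Ioo s₁ 1))
    (h : ∀ s ∈ Ioo s₁ 1,
      (aeval (![Polynomial.aeval s u + (γ + δ * s), 1] : Fin 2 → ℝ) Rn / (γ + δ) ^ k +
          Polynomial.aeval (Polynomial.aeval s u + (γ + δ * s)) a * Real.log |(γ : ℝ) + δ|) -
        (aeval (![Polynomial.aeval s u + (γ + δ * s), s] : Fin 2 → ℝ) Rn / (γ + δ * s) ^ k +
          Polynomial.aeval (Polynomial.aeval s u + (γ + δ * s)) a * Real.log |(γ : ℝ) + δ * s|) =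
        0) :
    a = 0 := by
  -- the real polynomials `w(s) = γ + δs` and `W(s) = u(s) + w(s)`
  obtain ⟨wp, hwp⟩ : ∃ wp : Polynomial ℝ,
      wp = Polynomial.C (γ : ℝ) + Polynomial.C (δ : ℝ) * Polynomial.X := ⟨_, rfl⟩
  obtain ⟨Wp, hWp⟩ : ∃ Wp : Polynomial ℝ, Wp = u.map (algebraMap ℚ ℝ) + wp := ⟨_, rfl⟩
  have hwe : ∀ s : ℝ, wp.eval s = (γ : ℝ) + δ * s := fun s => by simp [hwp]
  have hWe : ∀ s : ℝ, Wp.eval s = Polynomial.aeval s u + (γ + δ * s) := fun s => by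
    rw [hWp, Polynomial.eval_add, Polynomial.eval_map_algebraMap, hwe]
  obtain ⟨p₁, hp₁⟩ := exists_poly Wp 1 Rn
  obtain ⟨p₂, hp₂⟩ := exists_poly Wp Polynomial.X Rn
  obtain ⟨p₃, hp₃⟩ :=
    exists_poly Wp Polynomial.X (Polynomial.aeval (X 0 : MvPolynomial (Fin 2) ℚ) a)
  have hp₃' : ∀ s : ℝ,
      (Polynomial.aeval (Polynomial.aeval s u + (γ + δ * s)) a : ℝ) = p₃.eval s := fun s => by
    rw [← hp₃ s, ← Polynomial.aeval_algHom_apply, MvPolynomial.aeval_X, Matrix.cons_val_zero, hWe]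
  -- `g(s) log|γ+δs| = f(s)` on `(s₁, 1)` with `g = a(W)·w^k`
  obtain ⟨g, hg⟩ : ∃ g : Polynomial ℝ, g = p₃ * wp ^ k := ⟨_, rfl⟩
  obtain ⟨f, hf⟩ : ∃ f : Polynomial ℝ, f = Polynomial.C (((γ : ℝ) + δ) ^ k)⁻¹ * p₁ * wp ^ k -
    p₂ + Polynomial.C (Real.log |(γ : ℝ) + δ|) * p₃ * wp ^ k := ⟨_, rfl⟩
  have hfg : ∀ s ∈ Ioo s₁ 1, g.eval s * Real.log |(γ : ℝ) + δ * s| = f.eval s := by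
    intro s hs
    have hv : ((γ : ℝ) + δ * s) ^ k ≠ 0 := pow_ne_zero k (hvs s (Ioo_subset_Icc_self hs))
    have hV : ((γ : ℝ) + δ * s) ^ k * (((γ : ℝ) + δ * s) ^ k)⁻¹ = 1 := mul_inv_cancel₀ hv
    have h1 := h s hs
    have e₁ := hp₁ s
    have e₂ := hp₂ s
    simp only [Polynomial.eval_one, Polynomial.eval_X, hWe] at e₁ e₂
    rw [e₁, e₂, hp₃', div_eq_mul_inv, div_eq_mul_inv] at h1
    simp only [hg, hf, Polynomial.eval_mul, Polynomial.eval_pow, Polynomial.eval_sub,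
      Polynomial.eval_add, Polynomial.eval_C, hwe]
    linear_combination (-((γ : ℝ) + δ * s) ^ k) * h1 - p₂.eval s * hV
  have hg0 : g = 0 :=
    eq_zero_of_mul_log_affine (γ : ℝ) δ s₁ (by exact_mod_cast hδ) hs₁ hvs f g hfg
  -- `a ∘ W` vanishes on `(s₁, 1)`, an infinite set of values of `W`
  have hroot : ∀ s ∈ Ioo s₁ 1,
      (Polynomial.aeval (Polynomial.aeval s u + (γ + δ * s)) a : ℝ) = 0 := by
    intro s hs
    have hv : ((γ : ℝ) + δ * s) ^ k ≠ 0 := pow_ne_zero k (hvs s (Ioo_subset_Icc_self hs))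
    have h1 : g.eval s = 0 := by rw [hg0, Polynomial.eval_zero]
    rw [hg, Polynomial.eval_mul, Polynomial.eval_pow, hwe, ← hp₃' s] at h1
    exact (mul_eq_zero.1 h1).resolve_right hv
  have hΛ : a.map (algebraMap ℚ ℝ) = 0 := by
    apply Polynomial.eq_zero_of_infinite_isRoot
    refine ((Ioo_infinite hs₁).image hinj).mono ?_
    rintro _ ⟨σ, hσ, rfl⟩
    simp only [Set.mem_setOf_eq, Polynomial.IsRoot.def, Polynomial.eval_map_algebraMap]
    exact hroot σ hσ
  exact Polynomial.map_injective _ (algebraMap ℚ ℝ).injective (by rw [hΛ, Polynomial.map_zero])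

/-- Evaluating a substitution: `(bind₁ (f₀, f₁) R)(v) = R(f₀(v), f₁(v))`. [folklore] -/
theorem aeval_bind₁_vec (f₀ f₁ R : MvPolynomial (Fin 2) ℚ) (v : Fin 2 → ℝ) :
    aeval v (bind₁ ![f₀, f₁] R) = aeval ![aeval v f₀, aeval v f₁] R := by
  have hv : (fun i => aeval v ((![f₀, f₁] : Fin 2 → MvPolynomial (Fin 2) ℚ) i)) =
      ![aeval v f₀, aeval v f₁] := by
    funext i
    fin_cases i <;> simp
  rw [aeval_bind₁, hv]

/-- Continuity of `σ ↦ P(g(σ))` at a point where every coordinate of `g` is continuous.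
[folklore] -/
theorem continuousAt_aeval_comp (P : MvPolynomial (Fin 2) ℚ) (g : ℝ → Fin 2 → ℝ) (σ₀ : ℝ)
    (hg : ∀ i, ContinuousAt (fun σ => g σ i) σ₀) :
    ContinuousAt (fun σ => aeval (g σ) P) σ₀ := by
  induction P using MvPolynomial.induction_on with
  | C a => simp only [MvPolynomial.aeval_C]; exact continuousAt_const
  | add p q hp hq => simp only [map_add]; exact hp.add hq
  | mul_X p i hp => simp only [map_mul, MvPolynomial.aeval_X]; exact hp.mul (hg i)

/-- **FTC step.** If `∫_{(s',1)} φ = c − R(s')` for all `s'` in an open interval `(s₁, 1)` on whose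
closure `φ` is continuous, then `R` has derivative `φ(s)` at every `s ∈ (s₁, 1)` (FTC-1 at the
left end point). [folklore] -/
theorem hasDerivAt_of_integral_eq (φ R : ℝ → ℝ) (c s₁ s : ℝ) (hs : s ∈ Ioo s₁ 1)
    (hφ : ∀ σ ∈ Icc s₁ 1, ContinuousAt φ σ)
    (hint : ∀ s' ∈ Ioo s₁ 1, ∫ σ in Ioo s' 1, φ σ = c - R s') : HasDerivAt R (φ s) s := by
  have hco : ContinuousOn φ (Icc s 1) := fun σ hσ =>
    (hφ σ ⟨hs.1.le.trans hσ.1, hσ.2⟩).continuousWithinAt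
  have hg : HasDerivAt (fun s' => ∫ σ in s'..1, φ σ) (-φ s) s :=
    intervalIntegral.integral_hasDerivAt_left (hco.intervalIntegrable_of_Icc hs.2.le)
      (ContinuousAt.stronglyMeasurableAtFilter isOpen_Ioo
        (fun x hx => hφ x (Ioo_subset_Icc_self hx)) s hs)
      (hφ s (Ioo_subset_Icc_self hs))
  have heq : (fun s' => c - ∫ σ in s'..1, φ σ) =ᶠ[nhds s] R := by
    filter_upwards [Ioo_mem_nhds hs.1 hs.2] with s' hs'
    rw [intervalIntegral.integral_of_le hs'.2.le, integral_Ioc_eq_integral_Ioo, hint s' hs']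
    ring
  simpa using ((hasDerivAt_const s c).sub hg).congr_of_eventuallyEq heq.symm

/-- **Uniqueness of the derivative, cleared of denominators**: if
`d/ds (M(y,s)/(γ+δs)^{k+1}) = φ` at `s` (`γ + δs ≠ 0`), then
`φ·(γ+δs)^{k+2} = (∂₁M)(y,s)·(γ+δs) − (k+1)δ·M(y,s)`. [folklore] -/
theorem key_identity (γ δ : ℚ) (k : ℕ) (M : MvPolynomial (Fin 2) ℚ) (y s φ : ℝ)
    (hW : (γ : ℝ) + δ * s ≠ 0)
    (hM : HasDerivAt (fun s' : ℝ => aeval ![y, s'] M / ((γ : ℝ) + δ * s') ^ (k + 1)) φ s) :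
    φ * ((γ : ℝ) + δ * s) ^ (k + 2) =
      aeval ![y, s] (pderiv 1 M) * ((γ : ℝ) + δ * s) - (k + 1) * δ * aeval ![y, s] M := by
  -- adapted from `LinExact.key_identity`
  have h2 : HasDerivAt (fun s' : ℝ => (γ : ℝ) + δ * s') (δ : ℝ) s := by
    simpa using ((hasDerivAt_id s).const_mul (δ : ℝ)).const_add (γ : ℝ)
  have h5 := hM.unique
    ((LinExact.hasDerivAt_aeval_snd M y s).div (h2.fun_pow (k + 1)) (pow_ne_zero _ hW))
  rw [Nat.add_sub_cancel, eq_div_iff (pow_ne_zero 2 (pow_ne_zero _ hW))] at h5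
  push_cast at h5
  apply mul_right_cancel₀ (pow_ne_zero k hW)
  linear_combination h5

/-- **Steps 2–4 of `stub_gvDivision`** (no `log` term, exponent `k + 1`): the rational identity
along the graph gives `c·Rn − Rn(y,1)·w^{k+1} = (y − u − w)·G` (factor theorem); the FTC read at
`y = u(s) + w(s)z₁`, the `s`-derivative of this factorisation and the substitution
`θ : y ↦ u(s) + w(s)z₁` give the twisted identity with `Nt = (1 − z₁)·θ(G)/c`, `m = k`.
[cite: KontsevichZagier2001, §1.2] -/
theorem twisted (u : Polynomial ℚ) (γ δ : ℚ) (hδ : δ ≠ 0) (P Rn : MvPolynomial (Fin 2) ℚ) (k : ℕ)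
    (s₁ : ℝ) (hs₁ : s₁ < 1) (hvs : ∀ σ ∈ Icc s₁ 1, (γ : ℝ) + δ * σ ≠ 0)
    (hF : ∀ y : ℝ, ∀ s ∈ Ioo s₁ 1,
      ∫ σ in Ioo s 1, aeval (![(y - Polynomial.aeval σ u) / (γ + δ * σ), σ] : Fin 2 → ℝ) P /
          (γ + δ * σ) =
        aeval (![y, 1] : Fin 2 → ℝ) Rn / (γ + δ) ^ (k + 1) -
          aeval (![y, s] : Fin 2 → ℝ) Rn / (γ + δ * s) ^ (k + 1))
    (hzero : ∀ s ∈ Ioo s₁ 1,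
      ∫ σ in Ioo s 1, aeval (![(Polynomial.aeval s u + (γ + δ * s) - Polynomial.aeval σ u) /
          (γ + δ * σ), σ] : Fin 2 → ℝ) P / (γ + δ * σ) = 0) :
    ∃ Nt : MvPolynomial (Fin 2) ℚ,
      (C γ + C δ * X 1) ^ k * P =
        (Polynomial.aeval (X 1 : MvPolynomial (Fin 2) ℚ) (Polynomial.derivative u) + C δ * X 0) *
            pderiv 0 Nt -
          (C γ + C δ * X 1) * pderiv 1 Nt + C ((k : ℚ) * δ) * Nt := by
  -- names: `Uu = u(s)`, `Ud = u'(s)`, `w = γ + δs`, `A = u + w` (graph), `A' = u + w·z₁`,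
  -- `R1 = Rn(y, 1)`, `c = (γ+δ)^(k+1)`; the substitution is `θ = bind₁ ![A', X 1]`
  set Ud : MvPolynomial (Fin 2) ℚ := Polynomial.aeval (X 1) (Polynomial.derivative u) with hUd
  set w : MvPolynomial (Fin 2) ℚ := C γ + C δ * X 1 with hw
  obtain ⟨Uu, hUu⟩ : ∃ Uu : MvPolynomial (Fin 2) ℚ,
      Uu = Polynomial.aeval (X 1 : MvPolynomial (Fin 2) ℚ) u := ⟨_, rfl⟩
  obtain ⟨A, hA⟩ : ∃ A : MvPolynomial (Fin 2) ℚ, A = Uu + w := ⟨_, rfl⟩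
  obtain ⟨A', hA'⟩ : ∃ A' : MvPolynomial (Fin 2) ℚ, A' = Uu + w * X 0 := ⟨_, rfl⟩
  obtain ⟨c, hc⟩ : ∃ c : ℚ, c = (γ + δ) ^ (k + 1) := ⟨_, rfl⟩
  obtain ⟨R1, hR1⟩ : ∃ R1 : MvPolynomial (Fin 2) ℚ,
      R1 = bind₁ (![X 0, 1] : Fin 2 → MvPolynomial (Fin 2) ℚ) Rn := ⟨_, rfl⟩
  have h10 : (1 : Fin 2) ≠ 0 := by decide
  have h01 : (0 : Fin 2) ≠ 1 := by decide
  have hγδ : ((γ : ℝ) + δ) ≠ 0 := by simpa using hvs 1 ⟨hs₁.le, le_rfl⟩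
  have hc0 : c ≠ 0 := hc ▸ pow_ne_zero _ fun h => hγδ (by exact_mod_cast h)
  -- scalar facts
  have heU : ∀ v : Fin 2 → ℝ, aeval v Uu = Polynomial.aeval (v 1) u := fun v =>
    hUu ▸ GpDivision.aeval_scalar u v
  have hew : ∀ y s : ℝ, aeval ![y, s] w = (γ : ℝ) + δ * s := fun y s => by simp [hw, eq_ratCast]
  have heA' : ∀ y s : ℝ, aeval ![y, s] A' = Polynomial.aeval s u + ((γ : ℝ) + δ * s) * y :=
    fun y s => by simp [hA', heU, hew]
  have hw0 : pderiv 0 w = 0 := by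
    rw [hw, map_add, pderiv_C, pderiv_C_mul, pderiv_X_of_ne h10, mul_zero, add_zero]
  have hw1 : pderiv 1 w = C δ := by
    rw [hw, map_add, pderiv_C, pderiv_C_mul, pderiv_X_self, mul_one, zero_add]
  have hwne : w ≠ 0 := fun h => hδ (by simpa [hw1] using congrArg (pderiv 1) h)
  have hA1 : pderiv 1 A = Ud + C δ := by rw [hA, map_add, hUu, GpDivision.pderiv_one_scalar, hw1]
  have hA'0 : pderiv 0 A' = w := by
    rw [hA', map_add, hUu, GpDivision.pderiv_zero_scalar, pderiv_mul, hw0, pderiv_X_self]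
    ring
  have hA'1 : pderiv 1 A' = Ud + C δ * X 0 := by
    rw [hA', map_add, hUu, GpDivision.pderiv_one_scalar, pderiv_mul, hw1, pderiv_X_of_ne h01,
      mul_zero, add_zero]
  have hwk : pderiv 1 (w ^ (k + 1)) = ((k : MvPolynomial (Fin 2) ℚ) + 1) * w ^ k * C δ := by
    rw [Derivation.leibniz_pow, Nat.add_sub_cancel, hw1, smul_eq_mul, nsmul_eq_mul, Nat.cast_succ]
    ring
  have hR1d : pderiv 1 R1 = 0 := by simp [hR1, LinExact.pderiv_bind₁, Fin.sum_univ_two]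
  have hθ1 : (![A', X 1] : Fin 2 → MvPolynomial (Fin 2) ℚ) 1 = X 1 := by simp
  have hθU : bind₁ ![A', X 1] Uu = Uu := by rw [hUu, GpDivision.bind₁_scalar u _ hθ1]
  have hθUd : bind₁ ![A', X 1] Ud = Ud := by rw [hUd, GpDivision.bind₁_scalar _ _ hθ1]
  have hθw : bind₁ ![A', X 1] w = w := by simp [hw]
  have hθA : bind₁ ![A', X 1] A = A := by rw [hA, map_add, hθU, hθw]
  have hθX : bind₁ ![A', X 1] (X 0 : MvPolynomial (Fin 2) ℚ) = A' := by simp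
  have hAA' : A' - A = w * (X 0 - 1) := by rw [hA, hA']; ring
  -- STEP A (FTC at the points `y = u(s) + w(s)·z₁`): `P·w^(k+1) = θ(∂₁Rn)·w − (k+1)δ·θ(Rn)`
  have h1 : P * w ^ (k + 1) - (bind₁ ![A', X 1] (pderiv 1 Rn) * w -
      ((k : MvPolynomial (Fin 2) ℚ) + 1) * C δ * bind₁ ![A', X 1] Rn) = 0 := by
    refine GpDivision.eq_zero_of_aeval_eq_zero _ (Ioo s₁ 1) (Ioo_infinite hs₁) fun y s hs => ?_
    have hv : (γ : ℝ) + δ * s ≠ 0 := hvs s (Ioo_subset_Icc_self hs)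
    have hφ : ∀ σ ∈ Icc s₁ 1, ContinuousAt (fun σ : ℝ =>
        aeval (![(Polynomial.aeval s u + ((γ : ℝ) + δ * s) * y - Polynomial.aeval σ u) /
          (γ + δ * σ), σ] : Fin 2 → ℝ) P / (γ + δ * σ)) σ := by
      intro σ hσ
      have hc : ContinuousAt (fun σ : ℝ => (γ : ℝ) + δ * σ) σ := by fun_prop
      refine (continuousAt_aeval_comp P _ σ fun i => ?_).div hc (hvs σ hσ)
      fin_cases i
      · simp only [Fin.zero_eta, Matrix.cons_val_zero]
        exact (continuousAt_const.sub (Polynomial.continuousAt_aeval u)).div hc (hvs σ hσ)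
      · simp only [Fin.mk_one, Matrix.cons_val_one, Matrix.cons_val_fin_one]
        exact continuousAt_id
    have hD := hasDerivAt_of_integral_eq _ (fun s' : ℝ =>
        aeval (![Polynomial.aeval s u + ((γ : ℝ) + δ * s) * y, s'] : Fin 2 → ℝ) Rn /
          ((γ : ℝ) + δ * s') ^ (k + 1))
      (aeval (![Polynomial.aeval s u + ((γ : ℝ) + δ * s) * y, 1] : Fin 2 → ℝ) Rn /
        ((γ : ℝ) + δ) ^ (k + 1)) s₁ s hs hφ (hF _)
    have hkey := key_identity γ δ k Rn _ s _ hv hD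
    rw [add_sub_cancel_left, mul_div_cancel_left₀ _ hv] at hkey
    simp only [map_sub, map_mul, map_pow, map_add, map_natCast, map_one, MvPolynomial.aeval_C,
      eq_ratCast, hew, aeval_bind₁_vec, heA', aeval_X, Matrix.cons_val_one,
      Matrix.cons_val_fin_one]
    rw [show aeval (![y, s] : Fin 2 → ℝ) P =
      aeval (![y, s] : Fin 2 → ℝ) P / ((γ : ℝ) + δ * s) * ((γ : ℝ) + δ * s) by field_simp]
    linear_combination hkey
  -- STEP B (infinitely many zeros): `(c·Rn − R1·w^(k+1))(A, s) = 0`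
  have h2 : bind₁ ![A, X 1] (C c * Rn - R1 * w ^ (k + 1)) = 0 := by
    refine GpDivision.eq_zero_of_aeval_eq_zero _ (Ioo s₁ 1) (Ioo_infinite hs₁) fun y s hs => ?_
    have hv : (γ : ℝ) + δ * s ≠ 0 := hvs s (Ioo_subset_Icc_self hs)
    have hz := hzero s hs
    rw [hF _ s hs, sub_eq_zero, div_eq_div_iff (pow_ne_zero _ hγδ) (pow_ne_zero _ hv)] at hz
    have heA : aeval ![y, s] A = Polynomial.aeval s u + ((γ : ℝ) + δ * s) := by
      simp [hA, heU, hew]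
    simp only [aeval_bind₁_vec, map_sub, map_mul, map_pow, MvPolynomial.aeval_C, eq_ratCast, heA,
      hew, aeval_X, hR1, map_one, Matrix.cons_val_zero, Matrix.cons_val_one,
      Matrix.cons_val_fin_one, hc]
    push_cast
    linear_combination -hz
  -- STEP C (factor theorem): `c·Rn − R1·w^(k+1) = (y − A)·G`
  have h3 := GpDivision.X_sub_dvd A (C c * Rn - R1 * w ^ (k + 1))
  rw [h2, sub_zero] at h3
  obtain ⟨G, hG⟩ := h3
  -- STEP D (differentiate in `s`, apply `θ`, combine with STEP A, cancel one `w`)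
  have hE := congrArg (fun F => bind₁ ![A', X 1] (pderiv 1 F)) hG
  have hθG := congrArg (bind₁ ![A', X 1]) hG
  simp only [map_sub, pderiv_mul, pderiv_C, hR1d, hwk, pderiv_X_of_ne h01, hA1, zero_mul,
    zero_add, zero_sub, map_mul, map_add, map_neg, map_pow, map_natCast, map_one, bind₁_C_right,
    hθw, hθUd, hθX, hθA, hAA'] at hE hθG
  have hP : C c * w ^ k * P = -((Ud + C δ) * bind₁ ![A', X 1] G) +
      w * (X 0 - 1) * bind₁ ![A', X 1] (pderiv 1 G) -
      ((k : MvPolynomial (Fin 2) ℚ) + 1) * C δ * (X 0 - 1) * bind₁ ![A', X 1] G := by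
    refine mul_left_cancel₀ hwne ?_
    linear_combination (C c) * h1 + w * hE - (((k : MvPolynomial (Fin 2) ℚ) + 1) * C δ) * hθG
  -- chain rule for `θ G`
  have hG0 : pderiv 0 (bind₁ ![A', X 1] G) = w * bind₁ ![A', X 1] (pderiv 0 G) := by
    rw [LinExact.pderiv_bind₁, Fin.sum_univ_two]
    simp only [Matrix.cons_val_zero, Matrix.cons_val_one, Matrix.cons_val_fin_one]
    rw [hA'0, pderiv_X_of_ne h10, zero_mul, add_zero]
  have hG1 : pderiv 1 (bind₁ ![A', X 1] G) =
      (Ud + C δ * X 0) * bind₁ ![A', X 1] (pderiv 0 G) + bind₁ ![A', X 1] (pderiv 1 G) := by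
    rw [LinExact.pderiv_bind₁, Fin.sum_univ_two]
    simp only [Matrix.cons_val_zero, Matrix.cons_val_one, Matrix.cons_val_fin_one]
    rw [hA'1, pderiv_X_self, one_mul]
  -- the primitive `Nt = (1 − z₁)·θ(G)/c`
  have hcc : C c⁻¹ * C c = (1 : MvPolynomial (Fin 2) ℚ) := by rw [← C_mul, inv_mul_cancel₀ hc0, C_1]
  refine ⟨C c⁻¹ * ((1 - X 0) * bind₁ ![A', X 1] G), ?_⟩
  rw [show C ((k : ℚ) * δ) = (k : MvPolynomial (Fin 2) ℚ) * C δ by rw [C_mul, map_natCast]]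
  simp only [pderiv_mul, pderiv_C, map_sub, pderiv_X_self, pderiv_X_of_ne h01,
    Derivation.map_one_eq_zero, hG0, hG1, zero_mul, zero_add, zero_sub]
  linear_combination (C c⁻¹) * hP - (w ^ k * P) * hcc

end GvDivision

open GvDivision in
/-- **Linear-slope graph pencil, ELIMINATION + factor theorem** (stub `stub_gvDivision` of the crux
`TateFamilyKernel`, line `Sketch`). (i) Along the graph `y_s = u(s) + γ + δs` the `log`-coefficient
satisfies "polynomial × `log|γ+δs|` = rational function", hence `a = 0`
(`GvDivision.log_coeff_eq_zero`, via `LinResidues.eq_zero_of_mul_log_eq`); (ii)–(iii) with the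
exponent raised to `k + 1` (`Rn ↦ Rn·(γ+δs)`) the rational identity, the factor theorem in
`ℚ[s][y]`, the FTC `∂_s(Rn/v^{k+1}) = P̂/v` and the substitution `y ↦ u(s) + (γ+δs)z₁` give the
twisted identity with `m = k` (`GvDivision.twisted`). [cite: KontsevichZagier2001, §1.2] -/
theorem stub_gvDivision (u : Polynomial ℚ) (γ δ : ℚ) (hδ : δ ≠ 0) (P Rn : MvPolynomial (Fin 2) ℚ) (k : ℕ)
    (a : Polynomial ℚ) (s₁ : ℝ) (hs₁ : s₁ < 1) (hvs : ∀ σ ∈ Icc s₁ 1, (γ : ℝ) + δ * σ ≠ 0)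
    (hinj : InjOn (fun s : ℝ => Polynomial.aeval s u + (γ + δ * s)) (Ioo s₁ 1))
    (hF : ∀ y s : ℝ, s ≤ 1 → (∀ σ ∈ Icc s 1, (γ : ℝ) + δ * σ ≠ 0) →
      ∫ σ in Ioo s 1, aeval (![(y - Polynomial.aeval σ u) / (γ + δ * σ), σ] : Fin 2 → ℝ) P / (γ + δ * σ) =
        (aeval (![y, 1] : Fin 2 → ℝ) Rn / (γ + δ) ^ k + Polynomial.aeval y a * Real.log |(γ : ℝ) + δ|) -
        (aeval (![y, s] : Fin 2 → ℝ) Rn / (γ + δ * s) ^ k + Polynomial.aeval y a * Real.log |(γ : ℝ) + δ * s|))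
    (hzero : ∀ s ∈ Ioo s₁ 1,
      ∫ σ in Ioo s 1, aeval (![(Polynomial.aeval s u + (γ + δ * s) - Polynomial.aeval σ u) / (γ + δ * σ), σ] :
          Fin 2 → ℝ) P / (γ + δ * σ) = 0) :
    ∃ (Nt : MvPolynomial (Fin 2) ℚ) (m : ℕ),
      (C γ + C δ * X 1) ^ m * P =
        (Polynomial.aeval (X 1 : MvPolynomial (Fin 2) ℚ) (Polynomial.derivative u) + C δ * X 0) * pderiv 0 Nt -
          (C γ + C δ * X 1) * pderiv 1 Nt + C ((m : ℚ) * δ) * Nt := by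
  -- STEP 1: the `log`-coefficient vanishes
  have ha : a = 0 := log_coeff_eq_zero u γ δ hδ Rn k a s₁ hs₁ hvs hinj fun s hs => by
    rw [← hF _ s hs.2.le fun σ hσ => hvs σ ⟨hs.1.le.trans hσ.1, hσ.2⟩]
    exact hzero s hs
  subst ha
  -- exponent `k + 1` with `Rn·w`, then `GvDivision.twisted`
  have hγδ : ((γ : ℝ) + δ) ≠ 0 := by simpa using hvs 1 ⟨hs₁.le, le_rfl⟩
  refine (twisted u γ δ hδ P (Rn * (C γ + C δ * X 1)) k s₁ hs₁ hvs (fun y s hs => ?_) hzero).imp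
    fun Nt hNt => ⟨k, hNt⟩
  have hv : (γ : ℝ) + δ * s ≠ 0 := hvs s (Ioo_subset_Icc_self hs)
  rw [hF y s hs.2.le fun σ hσ => hvs σ ⟨hs.1.le.trans hσ.1, hσ.2⟩]
  simp only [map_zero, zero_mul, add_zero, map_mul, map_add, MvPolynomial.aeval_C, aeval_X,
    eq_ratCast, Matrix.cons_val_one, Matrix.cons_val_fin_one, mul_one]
  rw [pow_succ _ k, pow_succ _ k, mul_div_mul_right _ _ hγδ, mul_div_mul_right _ _ hv]

end Summit.KontsevichZagierPeriods.InverseLandau.TateFamilyKernel.Descent
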